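import Literature.Probability.LatticeModels.SixVertexGFFWick

/-!
# Full-plane and fusion asymptotics of the GFF multi-point functions `Ψ_k^{GFF}`
# (DKLM 2026, Part II §2.2)

H. Duminil-Copin, K. K. Kozlowski, P. Lammers, I. Manolescu, *Gaussian free field convergence of
the six-vertex model with `-1 ≤ Δ ≤ -1/2`*, arXiv:2603.06268 (2026) [DKLM2026SixVertexGFF],
Part II §2.2 (the properties of `Ψ_k` as a function of `u₁` that, together with harmonicity,
characterise `σ^k Ψ_k^{GFF}`):

> * **Full-plane asymptotics:** `Ψ_k` converges to a constant in `ℝ` as `|u₁| → ∞`.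
> * **Fusion asymptotics:** for any `i > 1` and `v ∈ {uᵢ, uᵢ'}`, as `u₁` tends to `v`,
>   `Ψ_k(u) = Ψ_2(u₁,u₁',uᵢ,uᵢ') Ψ_{k-2}(((uⱼ,uⱼ'))_{j ∉ {1,i}}) + O(1)`.

For the GFF functions `gffKPoint k u = Ψ_k^{GFF}(u)` themselves both properties follow from
Wick's rule (`gffKPoint_wick`, file `SixVertexGFFWick.lean`); this file proves them (with the
distinguished index `0` in the role of `1`):

* `tendsto_log_norm_sub_log_norm_cocompact`, `tendsto_greenPlane_sub_cocompact` —
  `G(x, a) - G(x, b) → 0` as `|x| → ∞`;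
* `tendsto_gffKPoint_two_cocompact`, **`tendsto_gffKPoint_cocompact`** — as `|u₀| → ∞`,
  `Ψ_{m+2}^{GFF}` tends to the explicit constant
  `∑_{j ≠ 0} (G(u₀', uⱼ') - G(u₀', uⱼ)) Ψ_m^{GFF}(rest)`;
* `continuousAt_gffKPoint_two`, **`continuousAt_gffKPoint_sub_fusion`** — near `v ∈ {uⱼ, uⱼ'}`
  the difference `Ψ_{m+2}^{GFF}(u) - Ψ_2^{GFF}(u₀,u₀',uⱼ,uⱼ') Ψ_m^{GFF}(rest)` is continuous
  (in particular bounded): the fusion asymptotics with an `O(1)` that is even continuous.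

## References

* H. Duminil-Copin, K. K. Kozlowski, P. Lammers, I. Manolescu, arXiv:2603.06268 (2026),
  Part II §2.2. [DKLM2026SixVertexGFF]
-/

noncomputable section

open Finset Filter Topology

namespace Literature.Probability.LatticeModels.SixVertex

/-! ### `log |x - a| - log |x - b| → 0` at infinity -/

/-- `log ‖a - x‖ - log ‖b - x‖ → 0` as `|x| → ∞`. [folklore] -/
theorem tendsto_log_norm_sub_log_norm_cocompact (a b : ℂ) :
    Tendsto (fun x : ℂ => Real.log ‖a - x‖ - Real.log ‖b - x‖) (cocompact ℂ) (𝓝 0) := by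
  -- `‖b - x‖ → ∞`, and `‖a - x‖ / ‖b - x‖ → 1`
  have hb : Tendsto (fun x : ℂ => ‖b - x‖) (cocompact ℂ) atTop := by
    have h := (tendsto_norm_cocompact_atTop (E := ℂ)).atTop_add
      (tendsto_const_nhds (x := -‖b‖))
    refine tendsto_atTop_mono (fun x => ?_) h
    rw [norm_sub_rev]
    linarith [norm_sub_norm_le x b]
  have hratio : Tendsto (fun x : ℂ => ‖a - x‖ / ‖b - x‖) (cocompact ℂ) (𝓝 1) := by
    have h1 : Tendsto (fun x : ℂ => (‖a - x‖ - ‖b - x‖) / ‖b - x‖) (cocompact ℂ) (𝓝 0) := by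
      refine squeeze_zero_norm (fun x => ?_) ((tendsto_const_nhds (x := ‖a - b‖)).div_atTop hb)
      rw [Real.norm_eq_abs, abs_div, abs_of_nonneg (norm_nonneg (b - x))]
      refine div_le_div_of_nonneg_right ?_ (norm_nonneg _)
      have := abs_norm_sub_norm_le (a - x) (b - x)
      rwa [sub_sub_sub_cancel_right] at this
    have h2 : ∀ᶠ x in cocompact ℂ, (‖a - x‖ - ‖b - x‖) / ‖b - x‖ + 1 = ‖a - x‖ / ‖b - x‖ := by
      filter_upwards [hb.eventually_gt_atTop 0] with x hx
      rw [div_add_one hx.ne', sub_add_cancel]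
    have h3 := h1.add_const 1
    rw [zero_add] at h3
    exact h3.congr' h2
  have hlog := (Real.continuousAt_log one_ne_zero).tendsto.comp hratio
  rw [Real.log_one] at hlog
  refine hlog.congr' ?_
  filter_upwards [hb.eventually_gt_atTop 0, (hb.eventually_gt_atTop 0).and
    ((tendsto_norm_cocompact_atTop (E := ℂ)).eventually_gt_atTop ‖a‖)] with x hx hx'
  have ha : 0 < ‖a - x‖ := by
    have : ‖a‖ < ‖x‖ := hx'.2
    rw [norm_sub_rev]
    linarith [norm_sub_norm_le x a, norm_nonneg (x - a),
      (lt_of_le_of_lt (norm_nonneg a) this)]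
  rw [Function.comp_apply, Real.log_div ha.ne' hx.ne']

/-- `G(x, a) - G(x, b) → 0` as `|x| → ∞`. [cite: DKLM2026SixVertexGFF, Part II §2.2] -/
theorem tendsto_greenPlane_sub_cocompact (a b : ℂ) :
    Tendsto (fun x : ℂ => greenPlane x a - greenPlane x b) (cocompact ℂ) (𝓝 0) := by
  have h := (tendsto_log_norm_sub_log_norm_cocompact a b).const_mul (-(1 / (2 * Real.pi)))
  rw [mul_zero] at h
  refine h.congr fun x => ?_
  simp only [greenPlane]
  ring

/-! ### Full-plane asymptotics -/

/-- The two-point function as `|u₀| → ∞`: `Ψ_2^{GFF} → G(u₀', u₁') - G(u₀', u₁)`.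
[cite: DKLM2026SixVertexGFF, Part II §2.2] -/
theorem tendsto_gffKPoint_two_cocompact (v : Fin 2 → ℂ × ℂ) :
    Tendsto (fun x : ℂ => gffKPoint 2 (Function.update v 0 (x, (v 0).2))) (cocompact ℂ)
      (𝓝 (greenPlane (v 0).2 (v 1).2 - greenPlane (v 0).2 (v 1).1)) := by
  have h := tendsto_greenPlane_sub_cocompact (v 1).1 (v 1).2
  have h2 := h.add_const (greenPlane (v 0).2 (v 1).2 - greenPlane (v 0).2 (v 1).1)
  rw [zero_add] at h2
  refine h2.congr fun x => ?_
  rw [gffKPoint_two]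
  simp only [Function.update_self, ne_eq, one_ne_zero, not_false_eq_true,
    Function.update_of_ne]
  ring

/-- **Full-plane asymptotics of `Ψ_k^{GFF}`**: as `|u₀| → ∞` (all other arguments fixed),
`Ψ_{m+2}^{GFF}(u) → ∑_{j ≠ 0} (G(u₀', uⱼ') - G(u₀', uⱼ)) · Ψ_m^{GFF}((uᵢ, uᵢ')_{i ∉ {0,j}})`,
a finite constant ("`Ψ_k` converges to a constant as `|u₁| → ∞`"). [cite: DKLM2026SixVertexGFF, Part II §2.2] -/
theorem tendsto_gffKPoint_cocompact {m : ℕ} (u : Fin (m + 2) → ℂ × ℂ) :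
    Tendsto (fun x : ℂ => gffKPoint (m + 2) (Function.update u 0 (x, (u 0).2))) (cocompact ℂ)
      (𝓝 (∑ j ∈ Finset.univ.erase (0 : Fin (m + 2)),
        (greenPlane (u 0).2 (u j).2 - greenPlane (u 0).2 (u j).1) *
          gffKPoint m (u ∘ skipPairEmb m j))) := by
  have hfun : (fun x : ℂ => gffKPoint (m + 2) (Function.update u 0 (x, (u 0).2))) = fun x =>
      ∑ j ∈ Finset.univ.erase (0 : Fin (m + 2)),
        gffKPoint 2 ![(Function.update u 0 (x, (u 0).2)) 0, (Function.update u 0 (x, (u 0).2)) j] *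
          gffKPoint m ((Function.update u 0 (x, (u 0).2)) ∘ skipPairEmb m j) :=
    funext fun x => gffKPoint_wick _
  rw [hfun]
  refine tendsto_finsetSum _ fun j hj => ?_
  have hj0 : j ≠ 0 := (Finset.mem_erase.mp hj).1
  -- the remaining arguments do not see `u₀`
  have hrest : ∀ x : ℂ, (Function.update u 0 (x, (u 0).2)) ∘ skipPairEmb m j = u ∘ skipPairEmb m j := by
    intro x
    funext i
    simp only [Function.comp_apply, Function.update_of_ne (skipPairEmb_ne_zero j i)]
  simp only [hrest]
  refine Tendsto.mul_const _ ?_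
  have h := tendsto_gffKPoint_two_cocompact ![u 0, u j]
  simp only [Matrix.cons_val_zero, Matrix.cons_val_one] at h
  refine h.congr fun x => ?_
  congr 1
  funext i
  fin_cases i
  · simp [Function.update_self]
  · simp [Function.update_of_ne hj0]

/-! ### Fusion asymptotics -/

/-- `x ↦ G(x, w)` is continuous away from `w`. [folklore] -/
theorem continuousAt_greenPlane_left (w x₀ : ℂ) (hx : x₀ ≠ w) :
    ContinuousAt (fun x : ℂ => greenPlane x w) x₀ := by
  unfold greenPlane
  refine ContinuousAt.mul continuousAt_const ?_
  refine (Real.continuousAt_log ?_).comp ?_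
  · exact (norm_pos_iff.mpr (sub_ne_zero.mpr (Ne.symm hx))).ne'
  · exact (continuous_norm.comp (continuous_const.sub continuous_id)).continuousAt

/-- The two-point function `x ↦ Ψ_2^{GFF}((x, u₀'), (u₁, u₁'))` is continuous away from
`u₁, u₁'`. [cite: DKLM2026SixVertexGFF, Part II §2.2] -/
theorem continuousAt_gffKPoint_two (v : Fin 2 → ℂ × ℂ) (x₀ : ℂ) (h1 : x₀ ≠ (v 1).1)
    (h2 : x₀ ≠ (v 1).2) :
    ContinuousAt (fun x : ℂ => gffKPoint 2 (Function.update v 0 (x, (v 0).2))) x₀ := by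
  have hfun : (fun x : ℂ => gffKPoint 2 (Function.update v 0 (x, (v 0).2))) = fun x =>
      greenPlane (v 0).2 (v 1).2 - greenPlane x (v 1).2 - greenPlane (v 0).2 (v 1).1 +
        greenPlane x (v 1).1 := by
    funext x
    rw [gffKPoint_two]
    simp only [Function.update_self, ne_eq, one_ne_zero, not_false_eq_true,
      Function.update_of_ne]
  rw [hfun]
  exact ((continuousAt_const.sub (continuousAt_greenPlane_left _ _ h2)).sub
    continuousAt_const).add (continuousAt_greenPlane_left _ _ h1)

/-- **Fusion asymptotics of `Ψ_k^{GFF}`**: fix `j ≠ 0` and a point `x₀` which may coincide with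
`uⱼ` or `uⱼ'` but is distinct from the points `u_{j'}, u_{j'}'`, `j' ∉ {0, j}`. Then, as a
function of `u₀ = x`, the difference
`Ψ_{m+2}^{GFF}(u) - Ψ_2^{GFF}(u₀, u₀', uⱼ, uⱼ') · Ψ_m^{GFF}((uᵢ, uᵢ')_{i ∉ {0,j}})`
is continuous at `x₀` — in particular `O(1)` as `u₀ → v ∈ {uⱼ, uⱼ'}` ("fusion asymptotics").
[cite: DKLM2026SixVertexGFF, Part II §2.2] -/
theorem continuousAt_gffKPoint_sub_fusion {m : ℕ} (u : Fin (m + 2) → ℂ × ℂ) {j : Fin (m + 2)}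
    (hj : j ≠ 0) (x₀ : ℂ)
    (hx : ∀ j', j' ≠ 0 → j' ≠ j → x₀ ≠ (u j').1 ∧ x₀ ≠ (u j').2) :
    ContinuousAt (fun x : ℂ => gffKPoint (m + 2) (Function.update u 0 (x, (u 0).2)) -
      gffKPoint 2 ![(x, (u 0).2), u j] * gffKPoint m (u ∘ skipPairEmb m j)) x₀ := by
  classical
  have hrest : ∀ (x : ℂ) (j' : Fin (m + 2)),
      (Function.update u 0 (x, (u 0).2)) ∘ skipPairEmb m j' = u ∘ skipPairEmb m j' := by
    intro x j'
    funext i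
    simp only [Function.comp_apply, Function.update_of_ne (skipPairEmb_ne_zero j' i)]
  have htwo : ∀ (x : ℂ) (j' : Fin (m + 2)), j' ≠ 0 →
      (![(Function.update u 0 (x, (u 0).2)) 0, (Function.update u 0 (x, (u 0).2)) j'] :
        Fin 2 → ℂ × ℂ) = Function.update ![u 0, u j'] 0 (x, (u 0).2) := by
    intro x j' hj'
    funext i
    fin_cases i
    · simp [Function.update_self]
    · simp [Function.update_of_ne hj']
  -- the difference is the sum of the Wick terms over `j' ≠ 0, j`
  have hfun : (fun x : ℂ => gffKPoint (m + 2) (Function.update u 0 (x, (u 0).2)) -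
      gffKPoint 2 ![(x, (u 0).2), u j] * gffKPoint m (u ∘ skipPairEmb m j)) = fun x =>
      ∑ j' ∈ (Finset.univ.erase (0 : Fin (m + 2))).erase j,
        gffKPoint 2 (Function.update ![u 0, u j'] 0 (x, (u 0).2)) *
          gffKPoint m (u ∘ skipPairEmb m j') := by
    funext x
    rw [gffKPoint_wick, ← Finset.add_sum_erase _ _ (Finset.mem_erase.mpr ⟨hj, Finset.mem_univ j⟩)]
    simp only [hrest, htwo x j hj]
    have h0 : (![(x, (u 0).2), u j] : Fin 2 → ℂ × ℂ) = Function.update ![u 0, u j] 0 (x, (u 0).2) := by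
      funext i
      fin_cases i
      · simp [Function.update_self]
      · simp
    rw [h0, add_sub_cancel_left]
    refine Finset.sum_congr rfl fun j' hj' => ?_
    rw [htwo x j' (Finset.mem_erase.mp (Finset.mem_erase.mp hj').2).1]
  rw [hfun]
  refine tendsto_finsetSum _ fun j' hj' => ?_
  have hj'0 : j' ≠ 0 := (Finset.mem_erase.mp (Finset.mem_erase.mp hj').2).1
  have hj'j : j' ≠ j := (Finset.mem_erase.mp hj').1
  refine ContinuousAt.mul ?_ continuousAt_const
  have h := continuousAt_gffKPoint_two ![u 0, u j'] x₀
  simp only [Matrix.cons_val_one, Matrix.cons_val_zero] at h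
  exact h (hx j' hj'0 hj'j).1 (hx j' hj'0 hj'j).2

end Literature.Probability.LatticeModels.SixVertex

end
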